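/-
Copyright (c) 2026 the pub-hodgecm-mathlib formalisation cell (harness21).  Prover seat hodgecm-mathlib-K2E3-p29 (g2): Track B «K2-LIT», hLiu418 = stmt-HodgeConjecture-24832;
socket #41, KIND W; LEAD F0P6-plan (g14) BATCH #143 (2) «(iii-fin)», desk K2E4-p10 (g9), boxes K2-defs1 + audit1.  DEFINITIONS WITH BODY + theorems
(no `instance`, no notation, no named-fact hypothesis, no `sorry`).
-/
import Summits.HodgeConjecture.HodgeConjecture.Theorems.K2LiuSiegelEisensteinKindWPartOfLetters   -- ★ `hPart_of_letters` (the `FvT` ∕ `hFfin` letter shapes; brings `kindWFinset`, `HA`, `unipDeltaLoc`)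
import Summits.HodgeConjecture.HodgeConjecture.Theorems.K2LiuBadPlaceWhittakerData                -- ★ `exists_mball` (+ ★ `K2LiuLocalRingValuationBalls`: `mball_antitone`, `valued_toPlace_uniformizer_*`)
import Summits.HodgeConjecture.HodgeConjecture.Theorems.K2LiuSkewLatticeShells                     -- ★ `isOpen_setOf_valued_le` (the coordinate condition is open)
import Summits.HodgeConjecture.HodgeConjecture.Theorems.K2LiuUnipDeltaRankOneHaar                   -- ★ `continuous_blkB_matA` (the chart coordinate `u ↦ B(u)` is continuous)
import HarnessLib

/-!
# Crux `HLiu418`, socket #41, KIND W — `K2LiuKindWFiniteLetterDefs` ((iii-fin)): THE CONTINUED FINITE LOCAL LETTER `Ffin` OF RECORD —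
# the limit of the BALL integrals of the local Whittaker integrand on `N_Δ(L⁺_v)` (Karel ∕ Φ5 shape), its HALF-PLANE IDENTITY `hFfin`, and its holomorphy from far-shell stability

Cell `hodgecm-mathlib`, crux item hLiu418 = `stmt-HodgeConjecture-24832` (helper lane `--supports … --as helper`, count-neutral), route of record `HCCMUnconditional`; squad K2 ∕
K2Liu, road `K2_Liu`, socket #41 `sig_K2LiuSiegelEisensteinContinuation`, KIND W; LEAD F0P6-plan (g14) BATCH #143 (2) «DEFINE `Ffin j S h v :=` the ★ Φ5 ball integral of the local
factor `FvT j S h v` (by value until (KW-fac) constructs it) … + `hFfin` holomorphy ∕ the integral identity on `{n∕2 < re}` in ★ `hPart_of_letters`' letter shape»; desk K2E4-p10 (g9)).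
★ `K2LiuSiegelEisensteinKindWPartOfLetters.hPart_of_letters` and ★∕📤 `kindW_block_of_record` take the CONTINUED finite local letters `Ffin : Fin m → skew → H(𝔸) → 𝔭 → ℂ → ℂ` BY
VALUE, subject to (E3-c) «continued = integral on `{n∕2 < re s}` at non-singular indices» and holomorphy on `{0 < re s}`.  THIS FILE DEFINES them, CHART-FREE on `N_Δ(L⁺_v) =
unipDeltaLoc v` (no Skew chart `ψc`, no trace letter `hΨ` enters the definition):
* §1 **`kindWLocalBall v π a`** — the Φ5 ball of exponent `a` pulled back to `N_Δ(L⁺_v)` through the ★ B2 chart coordinate `u ↦ B(u) = blkB (matA u)`: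
  `{y | ∀ i j (w ∣ v), |B(y)_{ij,w}|_w ≤ |ϖ_w|^a}` (`π` a uniformiser of `L⁺_v`, `hπ : |π| = q⁻¹`; ★ `continuous_blkB_matA` ⇒ open ⇒ measurable; ★ `exists_mball` ⇒ the balls
  `a = −k`, `k → ∞`, EXHAUST; ★ `mball_antitone` ⇒ monotone) — exactly the preimage of ★ Φ5's ball `{t : Skew | ∀ i j w, |t_{ij,w}| ≤ |ϖ_w|^a}` under `(ψc u).1 = B(matA u)`.
* §1 **`kindWFfin T₀ νv π FvT j S h v s`** `:= limUnder atTop (k ↦ ∫_{kindWLocalBall v π (−k)} conj ψ_S(ι_v y) · FvT j S h v s ((w_Δ)_v · y · h_v) dν_v)` at `v ∈ kindWFinset T₀ S h`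
  (the local factor `FvT` BY VALUE, in ★ `hPart_of_letters`' dependent shape), `:= 0` off it.  Karel's lemma (★ Φ5 `whittaker_setIntegral_ball_eq` after ★ B4
  `integral_unipDeltaLoc_eq_integral_skew_addChar`) says the sequence is EVENTUALLY CONSTANT, so the limit is the common value of the large-ball integrals for EVERY `s`;
  where the integrand is integrable it is the whole integral.
* §2 `tendsto_setIntegral_kindWLocalBall` ∕ **`kindWFfin_eq_integral`** — THE HALF-PLANE IDENTITY in ★ `hPart_of_letters`' `hFfin` letter shape VERBATIM, from the per-place
  integrability of the local integrand BY VALUE (Mathlib `tendsto_setIntegral_of_monotone` on the exhausting balls; NO chart, NO far-shell input): the tie feeds `hFfin` by name.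
* §3 **`kindWFfin_eq_setIntegral_of_stable`** ∕ **`differentiable_kindWFfin_of_stable`** ∕ **`differentiableOn_kindWFfin_of_stable`** — holomorphy: if the ball integrals are STABLE
  beyond an exponent `K` for every `s` (★ Φ5 `whittaker_setIntegral_ball_eq`'s conclusion, by value) then `kindWFfin = ∫_{ball(−K)}` for every `s`, hence `Differentiable ℂ` as soon as
  that one ball integral is (★ Φ5 `differentiable_whittaker`'s conclusion, by value) — the head's `hFfin : DifferentiableOn ℂ (Ffin j S h v) {0 < re}` letter.  Payer of the two
  by-value inputs = (KW-fac) (the constructor of `FvT`) through ★ B4 + ★ Φ5; off `kindWFinset` the letter is the constant `0`.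
[KudlaRallis1994, §2], [Shimura1997, §18.3–18.4], [Casselman1980, §3], [Tan1999, §3].
HONEST LABEL.  Count-neutral helper (definitions + letters), closes no socket: `HC_CM` is proved only modulo the 7 printed citations (2 remaining named inputs: hLiu418 =
`stmt-HodgeConjecture-24832`, h413 = `stmt-HodgeConjecture-24833`) until rung 0 closes.
-/

set_option autoImplicit false
-- the mandated namespace repeats the single-problem summit's segment (`HodgeConjecture.HodgeConjecture`)
set_option linter.dupNamespace false

noncomputable section

open scoped Matrix RestrictedProduct ENNReal NNReal Topology ComplexConjugate BigOperators
-- the `if v ∈ kindWFinset …` of the letter of record is classical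
open scoped Classical
open NumberField IsDedekindDomain MeasureTheory Measure Filter Set

namespace Summit.HodgeConjecture.HodgeConjecture.Cruxes.HLiu418.K2LiuKindWFiniteLetterDefs

open Literature.NumberTheory.Automorphic Literature.NumberTheory.GaloisRepresentations Literature.NumberTheory.LFunctions
open Literature.NumberTheory.GelbartRogawski1991 Literature.NumberTheory.GelbartRogawski1991.GRConstruction
open Literature.NumberTheory.GelbartRogawski1991.AdaptedBlocks
open Literature.NumberTheory.GelbartRogawski1991.UnitaryDualPair Literature.NumberTheory.GelbartRogawski1991.UnitaryDualPair.LocalSplitting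
open Literature.NumberTheory.K2Lit.SiegelDoubled
open Literature.NumberTheory.K2Lit.PlaceSplitting
open Literature.MeasureTheory.RestrictedProduct
open Summit.HodgeConjecture.HodgeConjecture.Cruxes.HLiu418.K2LiuSiegelUnipotentLocalDefs
open Summit.HodgeConjecture.HodgeConjecture.Cruxes.HLiu418.K2LiuSiegelUnipotentSplitDefs
open Summit.HodgeConjecture.HodgeConjecture.Cruxes.HLiu418.K2LiuSiegelUnipotentSplitAtDefs
open Summit.HodgeConjecture.HodgeConjecture.Cruxes.HLiu418.K2LiuSiegelUnipotentFourierDefs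
open Summit.HodgeConjecture.HodgeConjecture.Cruxes.HLiu418.K2LiuSiegelEisensteinKindWLetters
open Summit.HodgeConjecture.HodgeConjecture.Cruxes.HLiu418.K2LiuLocalRingValuationBalls (mball_antitone valued_toPlace_uniformizer_ne_zero valued_toPlace_uniformizer_le_one)
open Summit.HodgeConjecture.HodgeConjecture.Cruxes.HLiu418.K2LiuBadPlaceWhittakerData (exists_mball)
open Summit.HodgeConjecture.HodgeConjecture.Cruxes.HLiu418.K2LiuSkewLatticeShells (isOpen_setOf_valued_le)
open Summit.HodgeConjecture.HodgeConjecture.Cruxes.HLiu418.K2LiuUnipDeltaRankOneHaar (continuous_blkB_matA)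

variable (L : Type) [Field L] [NumberField L] [IsCMField L]
variable {N M n : ℕ} (e : Fin N × Fin M ≃ Fin n)
  (dV : Fin N → L) (hdV : ∀ i, IsCMField.complexConj L (dV i) = dV i)
  (dW : Fin M → L) (hdW : ∀ i, IsCMField.complexConj L (dW i) = dW i)

/-! ## §1 The balls on `N_Δ(L⁺_v)` and the continued letter `Ffin` of record -/

/-- **The Φ5 ball of exponent `a` on `N_Δ(L⁺_v)`**: the unipotent elements `y` whose chart coordinate `B(y) = blkB (matA y)` (★ B2: `(ψc y).1 = B(matA y)`) has all entries of
valuation `≤ |ϖ_w|^a` at every place `w ∣ v` of `L` — the preimage of ★ Φ5's Skew-carrier ball `{t | ∀ i j w, |t_{ij,w}| ≤ |ϖ_w|^a}`.  `π` is a uniformiser of `L⁺_v`.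
[cite: KudlaRallis1994, §2] [cite: Shimura1997, §18.3] -/
def kindWLocalBall (v : HeightOneSpectrum (𝓞 (Fp L))) (π : v.adicCompletion (Fp L)) (a : ℤ) : Set ↥(unipDeltaLoc L e dV hdV dW hdW v) :=
  {y | ∀ (i j : Fin n) (w : UnitaryGroup.PlacesOver L v),
    Valued.v (blkB (matA (Fp L) L (IsCMField.complexConj L) v n
      (y : UnitaryGroup.localPi L (IsCMField.complexConj L) (n + n) (hermD L e dV hdV dW hdW) v)) i j w) ≤ Valued.v (UnitaryGroup.toPlace v w π) ^ a}

/-- Unfolding of `kindWLocalBall`. [cite: KudlaRallis1994, §2] -/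
theorem mem_kindWLocalBall_iff (v : HeightOneSpectrum (𝓞 (Fp L))) (π : v.adicCompletion (Fp L)) (a : ℤ) (y : ↥(unipDeltaLoc L e dV hdV dW hdW v)) :
    y ∈ kindWLocalBall L e dV hdV dW hdW v π a ↔ ∀ (i j : Fin n) (w : UnitaryGroup.PlacesOver L v),
      Valued.v (blkB (matA (Fp L) L (IsCMField.complexConj L) v n
        (y : UnitaryGroup.localPi L (IsCMField.complexConj L) (n + n) (hermD L e dV hdV dW hdW) v)) i j w) ≤ Valued.v (UnitaryGroup.toPlace v w π) ^ a :=
  Iff.rfl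

variable [∀ v : HeightOneSpectrum (𝓞 (Fp L)), MeasurableSpace ↥(unipDeltaLoc L e dV hdV dW hdW v)]

/-- **THE CONTINUED FINITE LOCAL LETTER `Ffin` OF RECORD** (KIND W, (iii-fin)).  For the bad set `T₀`, the local carriers `νv`, a uniformiser `π` of each `L⁺_v`, and the local
factor families `FvT j S h v : ℂ → H(L⁺_v) → ℂ` of the `T(S,h)`-part (BY VALUE, in ★ `hPart_of_letters`' dependent shape; (KW-fac) constructs them):
at `v ∈ kindWFinset T₀ S h`, `Ffin j S h v s := lim_{k → ∞} ∫_{kindWLocalBall v π (−k)} conj ψ_S(ι_v y) · FvT j S h v s ((w_Δ)_v · y · h_v) dν_v(y)` — by Karel's lemma (★ Φ5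
`whittaker_setIntegral_ball_eq` through the ★ B4 chart transport) the ball integrals are eventually constant in `k` for EVERY `s`, so this is their common value, entire in `s` for
`K_v`-finite flat families, and equal to the whole local Whittaker integral wherever that converges (§2); off `kindWFinset T₀ S h` the letter is `0` (the presentation never reads it
there). [cite: KudlaRallis1994, §2] [cite: Shimura1997, §18.3–18.4] [cite: Casselman1980, §3] -/
def kindWFfin (T₀ : Finset (HeightOneSpectrum (𝓞 (Fp L))))
    (νv : ∀ v : HeightOneSpectrum (𝓞 (Fp L)), Measure ↥(unipDeltaLoc L e dV hdV dW hdW v))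
    (π : ∀ v : HeightOneSpectrum (𝓞 (Fp L)), v.adicCompletion (Fp L)) {m : ℕ}
    (FvT : Fin m → ∀ (S : skewMatrices ((IsCMField.complexConj L : L ≃ₐ[Fp L] L) : L →+* L) ((gramR L e dV hdV dW hdW).map (algebraMap (Fp L) L)))
      (h : HA L e dV hdV dW hdW) (v : (kindWFinset L e dV hdV dW hdW T₀ (S : Matrix (Fin n) (Fin n) L) h)),
      ℂ → UnitaryGroup.localPi L (IsCMField.complexConj L) (n + n) (hermD L e dV hdV dW hdW) v.1 → ℂ)
    (j : Fin m) (S : skewMatrices ((IsCMField.complexConj L : L ≃ₐ[Fp L] L) : L →+* L) ((gramR L e dV hdV dW hdW).map (algebraMap (Fp L) L)))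
    (h : HA L e dV hdV dW hdW) (v : HeightOneSpectrum (𝓞 (Fp L))) (s : ℂ) : ℂ :=
  if hv : v ∈ kindWFinset L e dV hdV dW hdW T₀ (S : Matrix (Fin n) (Fin n) L) h then
    limUnder atTop fun k : ℕ =>
      ∫ y in kindWLocalBall L e dV hdV dW hdW v (π v) (-(k : ℤ)),
        conj (unipDeltaChar L e dV hdV dW hdW (S : Matrix (Fin n) (Fin n) L)
            (locToAdelic L e dV hdV dW hdW v
              ((y : ↥(unipDeltaLoc L e dV hdV dW hdW v)) : UnitaryGroup.localPi L (IsCMField.complexConj L) (n + n) (hermD L e dV hdV dW hdW) v)) : ℂ) *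
          FvT j S h ⟨v, hv⟩ s (UnitaryGroup.evalPlace (Fp L) L (IsCMField.complexConj L) (n + n) (hermD L e dV hdV dW hdW) v
                (UnitaryGroup.finPart (Fp L) L (IsCMField.complexConj L) (n + n) (hermD L e dV hdV dW hdW) (weylDelta L e dV hdV dW hdW)) *
              ((y : ↥(unipDeltaLoc L e dV hdV dW hdW v)) : UnitaryGroup.localPi L (IsCMField.complexConj L) (n + n) (hermD L e dV hdV dW hdW) v) *
              UnitaryGroup.evalPlace (Fp L) L (IsCMField.complexConj L) (n + n) (hermD L e dV hdV dW hdW) v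
                (UnitaryGroup.finPart (Fp L) L (IsCMField.complexConj L) (n + n) (hermD L e dV hdV dW hdW) h)) ∂(νv v)
  else 0

/-- Off the places of the presentation the letter is `0`. [cite: KudlaRallis1994, §2] -/
theorem kindWFfin_of_not_mem (T₀ : Finset (HeightOneSpectrum (𝓞 (Fp L))))
    (νv : ∀ v : HeightOneSpectrum (𝓞 (Fp L)), Measure ↥(unipDeltaLoc L e dV hdV dW hdW v))
    (π : ∀ v : HeightOneSpectrum (𝓞 (Fp L)), v.adicCompletion (Fp L)) {m : ℕ}
    (FvT : Fin m → ∀ (S : skewMatrices ((IsCMField.complexConj L : L ≃ₐ[Fp L] L) : L →+* L) ((gramR L e dV hdV dW hdW).map (algebraMap (Fp L) L)))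
      (h : HA L e dV hdV dW hdW) (v : (kindWFinset L e dV hdV dW hdW T₀ (S : Matrix (Fin n) (Fin n) L) h)),
      ℂ → UnitaryGroup.localPi L (IsCMField.complexConj L) (n + n) (hermD L e dV hdV dW hdW) v.1 → ℂ)
    (j : Fin m) (S : skewMatrices ((IsCMField.complexConj L : L ≃ₐ[Fp L] L) : L →+* L) ((gramR L e dV hdV dW hdW).map (algebraMap (Fp L) L)))
    (h : HA L e dV hdV dW hdW) {v : HeightOneSpectrum (𝓞 (Fp L))} (hv : v ∉ kindWFinset L e dV hdV dW hdW T₀ (S : Matrix (Fin n) (Fin n) L) h) (s : ℂ) :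
    kindWFfin L e dV hdV dW hdW T₀ νv π FvT j S h v s = 0 := by
  rw [kindWFfin, dif_neg hv]

/-! ## §2 The balls exhaust `N_Δ(L⁺_v)`; the half-plane identity `hFfin` -/

section Balls

variable (v : HeightOneSpectrum (𝓞 (Fp L))) {π : v.adicCompletion (Fp L)} (hπ : Valued.v π = WithZero.exp (-1 : ℤ))

omit [∀ v : HeightOneSpectrum (𝓞 (Fp L)), MeasurableSpace ↥(unipDeltaLoc L e dV hdV dW hdW v)] in
include hπ in
/-- **the balls are open** (the coordinate `y ↦ B(y)_{ij,w}` is continuous, ★ `continuous_blkB_matA`, and each coordinate condition is open, ★ `isOpen_setOf_valued_le`).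
[cite: KudlaRallis1994, §2] -/
theorem isOpen_kindWLocalBall (a : ℤ) : IsOpen (kindWLocalBall L e dV hdV dW hdW v π a) := by
  have hset : kindWLocalBall L e dV hdV dW hdW v π a = ⋂ i : Fin n, ⋂ j : Fin n, ⋂ w : UnitaryGroup.PlacesOver L v,
      (fun y : ↥(unipDeltaLoc L e dV hdV dW hdW v) => blkB (matA (Fp L) L (IsCMField.complexConj L) v n
        (y : UnitaryGroup.localPi L (IsCMField.complexConj L) (n + n) (hermD L e dV hdV dW hdW) v)) i j w) ⁻¹'
        {x : w.1.adicCompletion L | Valued.v x ≤ Valued.v (UnitaryGroup.toPlace v w π) ^ a} := by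
    ext y
    simp only [kindWLocalBall, Set.mem_setOf_eq, Set.mem_iInter, Set.mem_preimage]
  rw [hset]
  refine isOpen_iInter_of_finite fun i => isOpen_iInter_of_finite fun j => isOpen_iInter_of_finite fun w => ?_
  refine (isOpen_setOf_valued_le (Fp L) L v hπ a w).preimage ?_
  exact ((continuous_apply w).comp ((continuous_apply j).comp ((continuous_apply i).comp
    ((continuous_blkB_matA (Fp L) L (IsCMField.complexConj L) v n).comp continuous_subtype_val))))

include hπ in
/-- the balls are measurable. [cite: KudlaRallis1994, §2] -/
theorem measurableSet_kindWLocalBall [BorelSpace ↥(unipDeltaLoc L e dV hdV dW hdW v)] (a : ℤ) :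
    MeasurableSet (kindWLocalBall L e dV hdV dW hdW v π a) :=
  (isOpen_kindWLocalBall L e dV hdV dW hdW v hπ a).measurableSet

omit [∀ v : HeightOneSpectrum (𝓞 (Fp L)), MeasurableSpace ↥(unipDeltaLoc L e dV hdV dW hdW v)] in
include hπ in
/-- **the balls decrease in the exponent**: `a ≤ a′ ⇒ ball a′ ⊆ ball a` (★ `mball_antitone`). [cite: KudlaRallis1994, §2] -/
theorem kindWLocalBall_antitone {a a' : ℤ} (haa' : a ≤ a') :
    kindWLocalBall L e dV hdV dW hdW v π a' ⊆ kindWLocalBall L e dV hdV dW hdW v π a := fun y hy =>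
  (mem_kindWLocalBall_iff L e dV hdV dW hdW v π a y).2
    (mball_antitone (Fp L) L v hπ haa' ((mem_kindWLocalBall_iff L e dV hdV dW hdW v π a' y).1 hy))

omit [∀ v : HeightOneSpectrum (𝓞 (Fp L)), MeasurableSpace ↥(unipDeltaLoc L e dV hdV dW hdW v)] in
include hπ in
/-- the balls of exponent `−k`, `k ∈ ℕ`, form a MONOTONE sequence. [cite: KudlaRallis1994, §2] -/
theorem monotone_kindWLocalBall_neg : Monotone fun k : ℕ => kindWLocalBall L e dV hdV dW hdW v π (-(k : ℤ)) :=
  fun _ _ hkk' => kindWLocalBall_antitone L e dV hdV dW hdW v hπ (by omega)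

omit [∀ v : HeightOneSpectrum (𝓞 (Fp L)), MeasurableSpace ↥(unipDeltaLoc L e dV hdV dW hdW v)] in
include hπ in
/-- **the balls exhaust `N_Δ(L⁺_v)`**: every `y` lies in `ball(−k)` for some `k ∈ ℕ` (★ `exists_mball` on the matrix `B(y)`). [cite: KudlaRallis1994, §2] -/
theorem iUnion_kindWLocalBall_neg : (⋃ k : ℕ, kindWLocalBall L e dV hdV dW hdW v π (-(k : ℤ))) = Set.univ := by
  refine Set.eq_univ_of_forall fun y => Set.mem_iUnion.2 ?_
  obtain ⟨a, ha⟩ := exists_mball (Fp L) L v hπ (blkB (matA (Fp L) L (IsCMField.complexConj L) v n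
    (y : UnitaryGroup.localPi L (IsCMField.complexConj L) (n + n) (hermD L e dV hdV dW hdW) v)))
  refine ⟨a.natAbs, (mem_kindWLocalBall_iff L e dV hdV dW hdW v π _ y).2 fun i j w => ?_⟩
  exact mball_antitone (Fp L) L v hπ (show -(a.natAbs : ℤ) ≤ a by omega) ha i j w

include hπ in
/-- **the ball integrals of an integrable function converge to its integral** (Mathlib `tendsto_setIntegral_of_monotone` on the exhausting monotone balls).
[cite: KudlaRallis1994, §2] [cite: Tan1999, §3] -/
theorem tendsto_setIntegral_kindWLocalBall [BorelSpace ↥(unipDeltaLoc L e dV hdV dW hdW v)] (ν : Measure ↥(unipDeltaLoc L e dV hdV dW hdW v))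
    {G : ↥(unipDeltaLoc L e dV hdV dW hdW v) → ℂ} (hG : Integrable G ν) :
    Tendsto (fun k : ℕ => ∫ y in kindWLocalBall L e dV hdV dW hdW v π (-(k : ℤ)), G y ∂ν) atTop (𝓝 (∫ y, G y ∂ν)) := by
  have h := tendsto_setIntegral_of_monotone (μ := ν) (fun k : ℕ => measurableSet_kindWLocalBall L e dV hdV dW hdW v hπ (-(k : ℤ)))
    (monotone_kindWLocalBall_neg L e dV hdV dW hdW v hπ) (by rw [iUnion_kindWLocalBall_neg L e dV hdV dW hdW v hπ]; exact hG.integrableOn)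
  rwa [iUnion_kindWLocalBall_neg L e dV hdV dW hdW v hπ, Measure.restrict_univ] at h

end Balls

set_option maxHeartbeats 400000 in -- MEASURED (as ★ `hPart_of_letters`, whose dependent `FvT` letter block this statement repeats): the default 200 000 fails at `whnf`∕`isDefEq`, 400 000 passes
/-- **THE HALF-PLANE IDENTITY `hFfin` OF ★ `hPart_of_letters`, VERBATIM, for the letter of record**: wherever the local Whittaker integrand of the factor `FvT j S h v` at `s` is
INTEGRABLE on `N_Δ(L⁺_v)` (letter `hint` BY VALUE — on `{n∕2 < re s}` it is ★ `K2LiuSiegelIntertwiningIntegrable`-payable for Siegel-section families), `Ffin j S h v s` IS the whole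
integral: the ball integrals converge to it and the limit is unique.  (The guards `n∕2 < re s`, `det S ≠ 0` of the letter are carried, unused.)
[cite: KudlaRallis1994, §1–§2] [cite: Tan1999, §2–§3] [cite: CasselsFrohlichANT1967, Ch. XV §3.3] -/
theorem kindWFfin_eq_integral [∀ v : HeightOneSpectrum (𝓞 (Fp L)), BorelSpace ↥(unipDeltaLoc L e dV hdV dW hdW v)]
    (T₀ : Finset (HeightOneSpectrum (𝓞 (Fp L))))
    (νv : ∀ v : HeightOneSpectrum (𝓞 (Fp L)), Measure ↥(unipDeltaLoc L e dV hdV dW hdW v))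
    {π : ∀ v : HeightOneSpectrum (𝓞 (Fp L)), v.adicCompletion (Fp L)} (hπ : ∀ v, Valued.v (π v) = WithZero.exp (-1 : ℤ)) {m : ℕ}
    (FvT : Fin m → ∀ (S : skewMatrices ((IsCMField.complexConj L : L ≃ₐ[Fp L] L) : L →+* L) ((gramR L e dV hdV dW hdW).map (algebraMap (Fp L) L)))
      (h : HA L e dV hdV dW hdW) (v : (kindWFinset L e dV hdV dW hdW T₀ (S : Matrix (Fin n) (Fin n) L) h)),
      ℂ → UnitaryGroup.localPi L (IsCMField.complexConj L) (n + n) (hermD L e dV hdV dW hdW) v.1 → ℂ)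
    (hint : ∀ (j : Fin m) (S : skewMatrices ((IsCMField.complexConj L : L ≃ₐ[Fp L] L) : L →+* L) ((gramR L e dV hdV dW hdW).map (algebraMap (Fp L) L)))
      (h : HA L e dV hdV dW hdW) (v : (kindWFinset L e dV hdV dW hdW T₀ (S : Matrix (Fin n) (Fin n) L) h)) (s : ℂ), (n : ℝ) / 2 < s.re → (S : Matrix (Fin n) (Fin n) L).det ≠ 0 →
      Integrable (fun y : ↥(unipDeltaLoc L e dV hdV dW hdW v.1) =>
        conj (unipDeltaChar L e dV hdV dW hdW (S : Matrix (Fin n) (Fin n) L)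
            (locToAdelic L e dV hdV dW hdW v.1
              ((y : ↥(unipDeltaLoc L e dV hdV dW hdW v.1)) : UnitaryGroup.localPi L (IsCMField.complexConj L) (n + n) (hermD L e dV hdV dW hdW) v.1)) : ℂ) *
          FvT j S h v s (UnitaryGroup.evalPlace (Fp L) L (IsCMField.complexConj L) (n + n) (hermD L e dV hdV dW hdW) v.1
                (UnitaryGroup.finPart (Fp L) L (IsCMField.complexConj L) (n + n) (hermD L e dV hdV dW hdW) (weylDelta L e dV hdV dW hdW)) *
              ((y : ↥(unipDeltaLoc L e dV hdV dW hdW v.1)) : UnitaryGroup.localPi L (IsCMField.complexConj L) (n + n) (hermD L e dV hdV dW hdW) v.1) *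
              UnitaryGroup.evalPlace (Fp L) L (IsCMField.complexConj L) (n + n) (hermD L e dV hdV dW hdW) v.1
                (UnitaryGroup.finPart (Fp L) L (IsCMField.complexConj L) (n + n) (hermD L e dV hdV dW hdW) h))) (νv v.1)) :
    ∀ (j : Fin m) (S : skewMatrices ((IsCMField.complexConj L : L ≃ₐ[Fp L] L) : L →+* L) ((gramR L e dV hdV dW hdW).map (algebraMap (Fp L) L))) (h : HA L e dV hdV dW hdW)
      (v : (kindWFinset L e dV hdV dW hdW T₀ (S : Matrix (Fin n) (Fin n) L) h)) (s : ℂ), (n : ℝ) / 2 < s.re → (S : Matrix (Fin n) (Fin n) L).det ≠ 0 →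
      kindWFfin L e dV hdV dW hdW T₀ νv π FvT j S h v.1 s = ∫ y, conj (unipDeltaChar L e dV hdV dW hdW (S : Matrix (Fin n) (Fin n) L)
            (locToAdelic L e dV hdV dW hdW v.1
              ((y : ↥(unipDeltaLoc L e dV hdV dW hdW v.1)) : UnitaryGroup.localPi L (IsCMField.complexConj L) (n + n) (hermD L e dV hdV dW hdW) v.1)) : ℂ) *
          FvT j S h v s (UnitaryGroup.evalPlace (Fp L) L (IsCMField.complexConj L) (n + n) (hermD L e dV hdV dW hdW) v.1
                (UnitaryGroup.finPart (Fp L) L (IsCMField.complexConj L) (n + n) (hermD L e dV hdV dW hdW) (weylDelta L e dV hdV dW hdW)) *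
              ((y : ↥(unipDeltaLoc L e dV hdV dW hdW v.1)) : UnitaryGroup.localPi L (IsCMField.complexConj L) (n + n) (hermD L e dV hdV dW hdW) v.1) *
              UnitaryGroup.evalPlace (Fp L) L (IsCMField.complexConj L) (n + n) (hermD L e dV hdV dW hdW) v.1
                (UnitaryGroup.finPart (Fp L) L (IsCMField.complexConj L) (n + n) (hermD L e dV hdV dW hdW) h)) ∂(νv v.1) := by
  intro j S h v s hs hdet
  rw [kindWFfin, dif_pos v.2]
  exact (tendsto_setIntegral_kindWLocalBall L e dV hdV dW hdW v.1 (hπ v.1) (νv v.1) (hint j S h v s hs hdet)).limUnder_eq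

/-! ## §3 Holomorphy from far-shell stability (★ Φ5's conclusions, by value) -/

set_option maxHeartbeats 400000 in -- MEASURED (as ★ `hPart_of_letters`, whose dependent `FvT` letter block this statement repeats): the default 200 000 fails at `whnf`∕`isDefEq`, 400 000 passes
/-- **`Ffin = ∫_{ball(−K)}` when the ball integrals are STABLE beyond `K`** (★ Φ5 `whittaker_setIntegral_ball_eq`'s conclusion at the place, by value): an eventually constant
sequence converges to its eventual value. [cite: KudlaRallis1994, §2] [cite: Shimura1997, §18.3] -/
theorem kindWFfin_eq_setIntegral_of_stable (T₀ : Finset (HeightOneSpectrum (𝓞 (Fp L))))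
    (νv : ∀ v : HeightOneSpectrum (𝓞 (Fp L)), Measure ↥(unipDeltaLoc L e dV hdV dW hdW v))
    (π : ∀ v : HeightOneSpectrum (𝓞 (Fp L)), v.adicCompletion (Fp L)) {m : ℕ}
    (FvT : Fin m → ∀ (S : skewMatrices ((IsCMField.complexConj L : L ≃ₐ[Fp L] L) : L →+* L) ((gramR L e dV hdV dW hdW).map (algebraMap (Fp L) L)))
      (h : HA L e dV hdV dW hdW) (v : (kindWFinset L e dV hdV dW hdW T₀ (S : Matrix (Fin n) (Fin n) L) h)),
      ℂ → UnitaryGroup.localPi L (IsCMField.complexConj L) (n + n) (hermD L e dV hdV dW hdW) v.1 → ℂ)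
    (j : Fin m) (S : skewMatrices ((IsCMField.complexConj L : L ≃ₐ[Fp L] L) : L →+* L) ((gramR L e dV hdV dW hdW).map (algebraMap (Fp L) L)))
    (h : HA L e dV hdV dW hdW) (v : (kindWFinset L e dV hdV dW hdW T₀ (S : Matrix (Fin n) (Fin n) L) h)) (s : ℂ) (K : ℕ)
    (hstable : ∀ k : ℕ, K ≤ k →
      ∫ y in kindWLocalBall L e dV hdV dW hdW v.1 (π v.1) (-(k : ℤ)),
        conj (unipDeltaChar L e dV hdV dW hdW (S : Matrix (Fin n) (Fin n) L)
            (locToAdelic L e dV hdV dW hdW v.1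
              ((y : ↥(unipDeltaLoc L e dV hdV dW hdW v.1)) : UnitaryGroup.localPi L (IsCMField.complexConj L) (n + n) (hermD L e dV hdV dW hdW) v.1)) : ℂ) *
          FvT j S h v s (UnitaryGroup.evalPlace (Fp L) L (IsCMField.complexConj L) (n + n) (hermD L e dV hdV dW hdW) v.1
                (UnitaryGroup.finPart (Fp L) L (IsCMField.complexConj L) (n + n) (hermD L e dV hdV dW hdW) (weylDelta L e dV hdV dW hdW)) *
              ((y : ↥(unipDeltaLoc L e dV hdV dW hdW v.1)) : UnitaryGroup.localPi L (IsCMField.complexConj L) (n + n) (hermD L e dV hdV dW hdW) v.1) *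
              UnitaryGroup.evalPlace (Fp L) L (IsCMField.complexConj L) (n + n) (hermD L e dV hdV dW hdW) v.1
                (UnitaryGroup.finPart (Fp L) L (IsCMField.complexConj L) (n + n) (hermD L e dV hdV dW hdW) h)) ∂(νv v.1) =
      ∫ y in kindWLocalBall L e dV hdV dW hdW v.1 (π v.1) (-(K : ℤ)),
        conj (unipDeltaChar L e dV hdV dW hdW (S : Matrix (Fin n) (Fin n) L)
            (locToAdelic L e dV hdV dW hdW v.1
              ((y : ↥(unipDeltaLoc L e dV hdV dW hdW v.1)) : UnitaryGroup.localPi L (IsCMField.complexConj L) (n + n) (hermD L e dV hdV dW hdW) v.1)) : ℂ) *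
          FvT j S h v s (UnitaryGroup.evalPlace (Fp L) L (IsCMField.complexConj L) (n + n) (hermD L e dV hdV dW hdW) v.1
                (UnitaryGroup.finPart (Fp L) L (IsCMField.complexConj L) (n + n) (hermD L e dV hdV dW hdW) (weylDelta L e dV hdV dW hdW)) *
              ((y : ↥(unipDeltaLoc L e dV hdV dW hdW v.1)) : UnitaryGroup.localPi L (IsCMField.complexConj L) (n + n) (hermD L e dV hdV dW hdW) v.1) *
              UnitaryGroup.evalPlace (Fp L) L (IsCMField.complexConj L) (n + n) (hermD L e dV hdV dW hdW) v.1
                (UnitaryGroup.finPart (Fp L) L (IsCMField.complexConj L) (n + n) (hermD L e dV hdV dW hdW) h)) ∂(νv v.1)) :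
    kindWFfin L e dV hdV dW hdW T₀ νv π FvT j S h v.1 s =
      ∫ y in kindWLocalBall L e dV hdV dW hdW v.1 (π v.1) (-(K : ℤ)),
        conj (unipDeltaChar L e dV hdV dW hdW (S : Matrix (Fin n) (Fin n) L)
            (locToAdelic L e dV hdV dW hdW v.1
              ((y : ↥(unipDeltaLoc L e dV hdV dW hdW v.1)) : UnitaryGroup.localPi L (IsCMField.complexConj L) (n + n) (hermD L e dV hdV dW hdW) v.1)) : ℂ) *
          FvT j S h v s (UnitaryGroup.evalPlace (Fp L) L (IsCMField.complexConj L) (n + n) (hermD L e dV hdV dW hdW) v.1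
                (UnitaryGroup.finPart (Fp L) L (IsCMField.complexConj L) (n + n) (hermD L e dV hdV dW hdW) (weylDelta L e dV hdV dW hdW)) *
              ((y : ↥(unipDeltaLoc L e dV hdV dW hdW v.1)) : UnitaryGroup.localPi L (IsCMField.complexConj L) (n + n) (hermD L e dV hdV dW hdW) v.1) *
              UnitaryGroup.evalPlace (Fp L) L (IsCMField.complexConj L) (n + n) (hermD L e dV hdV dW hdW) v.1
                (UnitaryGroup.finPart (Fp L) L (IsCMField.complexConj L) (n + n) (hermD L e dV hdV dW hdW) h)) ∂(νv v.1) := by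
  rw [kindWFfin, dif_pos v.2]
  refine Filter.Tendsto.limUnder_eq (tendsto_const_nhds.congr' ?_)
  filter_upwards [Filter.eventually_ge_atTop K] with k hk
  exact (hstable k hk).symm

set_option maxHeartbeats 400000 in -- MEASURED (as ★ `hPart_of_letters`, whose dependent `FvT` letter block this statement repeats): the default 200 000 fails at `whnf`∕`isDefEq`, 400 000 passes
/-- **HOLOMORPHY FROM STABILITY**: if for EVERY `s` the ball integrals are stable beyond one exponent `K` (★ Φ5 `whittaker_setIntegral_ball_eq`: `K = K₁ + 4b + 2b′ − 1` depends on the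
family, the index and the level, not on `s`) and the `ball(−K)` integral is entire in `s` (★ Φ5 `differentiable_whittaker` for continuous, entire, locally bounded families), then
`s ↦ Ffin j S h v s` is ENTIRE. [cite: KudlaRallis1994, §2] [cite: Shimura1997, §18.3–18.4] [cite: Casselman1980, §3] -/
theorem differentiable_kindWFfin_of_stable (T₀ : Finset (HeightOneSpectrum (𝓞 (Fp L))))
    (νv : ∀ v : HeightOneSpectrum (𝓞 (Fp L)), Measure ↥(unipDeltaLoc L e dV hdV dW hdW v))
    (π : ∀ v : HeightOneSpectrum (𝓞 (Fp L)), v.adicCompletion (Fp L)) {m : ℕ}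
    (FvT : Fin m → ∀ (S : skewMatrices ((IsCMField.complexConj L : L ≃ₐ[Fp L] L) : L →+* L) ((gramR L e dV hdV dW hdW).map (algebraMap (Fp L) L)))
      (h : HA L e dV hdV dW hdW) (v : (kindWFinset L e dV hdV dW hdW T₀ (S : Matrix (Fin n) (Fin n) L) h)),
      ℂ → UnitaryGroup.localPi L (IsCMField.complexConj L) (n + n) (hermD L e dV hdV dW hdW) v.1 → ℂ)
    (j : Fin m) (S : skewMatrices ((IsCMField.complexConj L : L ≃ₐ[Fp L] L) : L →+* L) ((gramR L e dV hdV dW hdW).map (algebraMap (Fp L) L)))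
    (h : HA L e dV hdV dW hdW) (v : (kindWFinset L e dV hdV dW hdW T₀ (S : Matrix (Fin n) (Fin n) L) h)) (K : ℕ)
    (hstable : ∀ (s : ℂ) (k : ℕ), K ≤ k →
      ∫ y in kindWLocalBall L e dV hdV dW hdW v.1 (π v.1) (-(k : ℤ)),
        conj (unipDeltaChar L e dV hdV dW hdW (S : Matrix (Fin n) (Fin n) L)
            (locToAdelic L e dV hdV dW hdW v.1
              ((y : ↥(unipDeltaLoc L e dV hdV dW hdW v.1)) : UnitaryGroup.localPi L (IsCMField.complexConj L) (n + n) (hermD L e dV hdV dW hdW) v.1)) : ℂ) *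
          FvT j S h v s (UnitaryGroup.evalPlace (Fp L) L (IsCMField.complexConj L) (n + n) (hermD L e dV hdV dW hdW) v.1
                (UnitaryGroup.finPart (Fp L) L (IsCMField.complexConj L) (n + n) (hermD L e dV hdV dW hdW) (weylDelta L e dV hdV dW hdW)) *
              ((y : ↥(unipDeltaLoc L e dV hdV dW hdW v.1)) : UnitaryGroup.localPi L (IsCMField.complexConj L) (n + n) (hermD L e dV hdV dW hdW) v.1) *
              UnitaryGroup.evalPlace (Fp L) L (IsCMField.complexConj L) (n + n) (hermD L e dV hdV dW hdW) v.1
                (UnitaryGroup.finPart (Fp L) L (IsCMField.complexConj L) (n + n) (hermD L e dV hdV dW hdW) h)) ∂(νv v.1) =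
      ∫ y in kindWLocalBall L e dV hdV dW hdW v.1 (π v.1) (-(K : ℤ)),
        conj (unipDeltaChar L e dV hdV dW hdW (S : Matrix (Fin n) (Fin n) L)
            (locToAdelic L e dV hdV dW hdW v.1
              ((y : ↥(unipDeltaLoc L e dV hdV dW hdW v.1)) : UnitaryGroup.localPi L (IsCMField.complexConj L) (n + n) (hermD L e dV hdV dW hdW) v.1)) : ℂ) *
          FvT j S h v s (UnitaryGroup.evalPlace (Fp L) L (IsCMField.complexConj L) (n + n) (hermD L e dV hdV dW hdW) v.1
                (UnitaryGroup.finPart (Fp L) L (IsCMField.complexConj L) (n + n) (hermD L e dV hdV dW hdW) (weylDelta L e dV hdV dW hdW)) *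
              ((y : ↥(unipDeltaLoc L e dV hdV dW hdW v.1)) : UnitaryGroup.localPi L (IsCMField.complexConj L) (n + n) (hermD L e dV hdV dW hdW) v.1) *
              UnitaryGroup.evalPlace (Fp L) L (IsCMField.complexConj L) (n + n) (hermD L e dV hdV dW hdW) v.1
                (UnitaryGroup.finPart (Fp L) L (IsCMField.complexConj L) (n + n) (hermD L e dV hdV dW hdW) h)) ∂(νv v.1))
    (hdiff : Differentiable ℂ fun s : ℂ =>
      ∫ y in kindWLocalBall L e dV hdV dW hdW v.1 (π v.1) (-(K : ℤ)),
        conj (unipDeltaChar L e dV hdV dW hdW (S : Matrix (Fin n) (Fin n) L)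
            (locToAdelic L e dV hdV dW hdW v.1
              ((y : ↥(unipDeltaLoc L e dV hdV dW hdW v.1)) : UnitaryGroup.localPi L (IsCMField.complexConj L) (n + n) (hermD L e dV hdV dW hdW) v.1)) : ℂ) *
          FvT j S h v s (UnitaryGroup.evalPlace (Fp L) L (IsCMField.complexConj L) (n + n) (hermD L e dV hdV dW hdW) v.1
                (UnitaryGroup.finPart (Fp L) L (IsCMField.complexConj L) (n + n) (hermD L e dV hdV dW hdW) (weylDelta L e dV hdV dW hdW)) *
              ((y : ↥(unipDeltaLoc L e dV hdV dW hdW v.1)) : UnitaryGroup.localPi L (IsCMField.complexConj L) (n + n) (hermD L e dV hdV dW hdW) v.1) *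
              UnitaryGroup.evalPlace (Fp L) L (IsCMField.complexConj L) (n + n) (hermD L e dV hdV dW hdW) v.1
                (UnitaryGroup.finPart (Fp L) L (IsCMField.complexConj L) (n + n) (hermD L e dV hdV dW hdW) h)) ∂(νv v.1)) :
    Differentiable ℂ (kindWFfin L e dV hdV dW hdW T₀ νv π FvT j S h v.1) := by
  have hfun : kindWFfin L e dV hdV dW hdW T₀ νv π FvT j S h v.1 = fun s : ℂ =>
      ∫ y in kindWLocalBall L e dV hdV dW hdW v.1 (π v.1) (-(K : ℤ)),
        conj (unipDeltaChar L e dV hdV dW hdW (S : Matrix (Fin n) (Fin n) L)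
            (locToAdelic L e dV hdV dW hdW v.1
              ((y : ↥(unipDeltaLoc L e dV hdV dW hdW v.1)) : UnitaryGroup.localPi L (IsCMField.complexConj L) (n + n) (hermD L e dV hdV dW hdW) v.1)) : ℂ) *
          FvT j S h v s (UnitaryGroup.evalPlace (Fp L) L (IsCMField.complexConj L) (n + n) (hermD L e dV hdV dW hdW) v.1
                (UnitaryGroup.finPart (Fp L) L (IsCMField.complexConj L) (n + n) (hermD L e dV hdV dW hdW) (weylDelta L e dV hdV dW hdW)) *
              ((y : ↥(unipDeltaLoc L e dV hdV dW hdW v.1)) : UnitaryGroup.localPi L (IsCMField.complexConj L) (n + n) (hermD L e dV hdV dW hdW) v.1) *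
              UnitaryGroup.evalPlace (Fp L) L (IsCMField.complexConj L) (n + n) (hermD L e dV hdV dW hdW) v.1
                (UnitaryGroup.finPart (Fp L) L (IsCMField.complexConj L) (n + n) (hermD L e dV hdV dW hdW) h)) ∂(νv v.1) :=
    funext fun s => kindWFfin_eq_setIntegral_of_stable L e dV hdV dW hdW T₀ νv π FvT j S h v s K (hstable s)
  rw [hfun]
  exact hdiff

set_option maxHeartbeats 400000 in -- MEASURED (as ★ `hPart_of_letters`, whose dependent `FvT` letter block this statement repeats): the default 200 000 fails at `whnf`∕`isDefEq`, 400 000 passes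
/-- **THE HEAD's HOLOMORPHY LETTER `hFfin`** (`DifferentiableOn ℂ (Ffin j S h v) {0 < re}`, ★ `kindW_block_of_record`'s binder) at a place of the presentation, from far-shell
stability + differentiability of one ball integral (by value; payer (KW-fac) through ★ B4 + ★ Φ5). [cite: KudlaRallis1994, §2] [cite: Shimura1997, §18.3–18.4] -/
theorem differentiableOn_kindWFfin_of_stable (T₀ : Finset (HeightOneSpectrum (𝓞 (Fp L))))
    (νv : ∀ v : HeightOneSpectrum (𝓞 (Fp L)), Measure ↥(unipDeltaLoc L e dV hdV dW hdW v))
    (π : ∀ v : HeightOneSpectrum (𝓞 (Fp L)), v.adicCompletion (Fp L)) {m : ℕ}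
    (FvT : Fin m → ∀ (S : skewMatrices ((IsCMField.complexConj L : L ≃ₐ[Fp L] L) : L →+* L) ((gramR L e dV hdV dW hdW).map (algebraMap (Fp L) L)))
      (h : HA L e dV hdV dW hdW) (v : (kindWFinset L e dV hdV dW hdW T₀ (S : Matrix (Fin n) (Fin n) L) h)),
      ℂ → UnitaryGroup.localPi L (IsCMField.complexConj L) (n + n) (hermD L e dV hdV dW hdW) v.1 → ℂ)
    (j : Fin m) (S : skewMatrices ((IsCMField.complexConj L : L ≃ₐ[Fp L] L) : L →+* L) ((gramR L e dV hdV dW hdW).map (algebraMap (Fp L) L)))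
    (h : HA L e dV hdV dW hdW) (v : (kindWFinset L e dV hdV dW hdW T₀ (S : Matrix (Fin n) (Fin n) L) h)) (K : ℕ)
    (hstable : ∀ (s : ℂ) (k : ℕ), K ≤ k →
      ∫ y in kindWLocalBall L e dV hdV dW hdW v.1 (π v.1) (-(k : ℤ)),
        conj (unipDeltaChar L e dV hdV dW hdW (S : Matrix (Fin n) (Fin n) L)
            (locToAdelic L e dV hdV dW hdW v.1
              ((y : ↥(unipDeltaLoc L e dV hdV dW hdW v.1)) : UnitaryGroup.localPi L (IsCMField.complexConj L) (n + n) (hermD L e dV hdV dW hdW) v.1)) : ℂ) *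
          FvT j S h v s (UnitaryGroup.evalPlace (Fp L) L (IsCMField.complexConj L) (n + n) (hermD L e dV hdV dW hdW) v.1
                (UnitaryGroup.finPart (Fp L) L (IsCMField.complexConj L) (n + n) (hermD L e dV hdV dW hdW) (weylDelta L e dV hdV dW hdW)) *
              ((y : ↥(unipDeltaLoc L e dV hdV dW hdW v.1)) : UnitaryGroup.localPi L (IsCMField.complexConj L) (n + n) (hermD L e dV hdV dW hdW) v.1) *
              UnitaryGroup.evalPlace (Fp L) L (IsCMField.complexConj L) (n + n) (hermD L e dV hdV dW hdW) v.1
                (UnitaryGroup.finPart (Fp L) L (IsCMField.complexConj L) (n + n) (hermD L e dV hdV dW hdW) h)) ∂(νv v.1) =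
      ∫ y in kindWLocalBall L e dV hdV dW hdW v.1 (π v.1) (-(K : ℤ)),
        conj (unipDeltaChar L e dV hdV dW hdW (S : Matrix (Fin n) (Fin n) L)
            (locToAdelic L e dV hdV dW hdW v.1
              ((y : ↥(unipDeltaLoc L e dV hdV dW hdW v.1)) : UnitaryGroup.localPi L (IsCMField.complexConj L) (n + n) (hermD L e dV hdV dW hdW) v.1)) : ℂ) *
          FvT j S h v s (UnitaryGroup.evalPlace (Fp L) L (IsCMField.complexConj L) (n + n) (hermD L e dV hdV dW hdW) v.1
                (UnitaryGroup.finPart (Fp L) L (IsCMField.complexConj L) (n + n) (hermD L e dV hdV dW hdW) (weylDelta L e dV hdV dW hdW)) *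
              ((y : ↥(unipDeltaLoc L e dV hdV dW hdW v.1)) : UnitaryGroup.localPi L (IsCMField.complexConj L) (n + n) (hermD L e dV hdV dW hdW) v.1) *
              UnitaryGroup.evalPlace (Fp L) L (IsCMField.complexConj L) (n + n) (hermD L e dV hdV dW hdW) v.1
                (UnitaryGroup.finPart (Fp L) L (IsCMField.complexConj L) (n + n) (hermD L e dV hdV dW hdW) h)) ∂(νv v.1))
    (hdiff : Differentiable ℂ fun s : ℂ =>
      ∫ y in kindWLocalBall L e dV hdV dW hdW v.1 (π v.1) (-(K : ℤ)),
        conj (unipDeltaChar L e dV hdV dW hdW (S : Matrix (Fin n) (Fin n) L)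
            (locToAdelic L e dV hdV dW hdW v.1
              ((y : ↥(unipDeltaLoc L e dV hdV dW hdW v.1)) : UnitaryGroup.localPi L (IsCMField.complexConj L) (n + n) (hermD L e dV hdV dW hdW) v.1)) : ℂ) *
          FvT j S h v s (UnitaryGroup.evalPlace (Fp L) L (IsCMField.complexConj L) (n + n) (hermD L e dV hdV dW hdW) v.1
                (UnitaryGroup.finPart (Fp L) L (IsCMField.complexConj L) (n + n) (hermD L e dV hdV dW hdW) (weylDelta L e dV hdV dW hdW)) *
              ((y : ↥(unipDeltaLoc L e dV hdV dW hdW v.1)) : UnitaryGroup.localPi L (IsCMField.complexConj L) (n + n) (hermD L e dV hdV dW hdW) v.1) *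
              UnitaryGroup.evalPlace (Fp L) L (IsCMField.complexConj L) (n + n) (hermD L e dV hdV dW hdW) v.1
                (UnitaryGroup.finPart (Fp L) L (IsCMField.complexConj L) (n + n) (hermD L e dV hdV dW hdW) h)) ∂(νv v.1)) :
    DifferentiableOn ℂ (kindWFfin L e dV hdV dW hdW T₀ νv π FvT j S h v.1) {s : ℂ | 0 < s.re} :=
  (differentiable_kindWFfin_of_stable L e dV hdV dW hdW T₀ νv π FvT j S h v K hstable hdiff).differentiableOn

end Summit.HodgeConjecture.HodgeConjecture.Cruxes.HLiu418.K2LiuKindWFiniteLetterDefs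

end
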